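import Literature.AlgebraicGeometry.Surfaces.K3BettiNumbersProofs
import Literature.Geometry.ComplexAnalytic.HolomorphicCechH1
import HarnessLib

/-!
# The odd Betti numbers of a K3 surface vanish — reduction to GAGA Thm. 1 for `H¹(S, 𝒪_S)`, derived-functor form

Family `hodge`, layer `Literature/AlgebraicGeometry/Surfaces`. Theorems-only companion (no
definition, no named fact; D-0026) of `K3BettiNumbers.lean` / `K3BettiNumbersProofs.lean`,
composing the two halves the tree has proved around the named fact
`Huybrechts_K3_oddBetti_vanish` (Huybrechts, *Lectures on K3 Surfaces*, Ch. 1 §3.2–3.3: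
`b₁(S) = b₃(S) = 0` for a projective K3 surface `S`):

* ANALYTIC half (`Geometry/ComplexAnalytic/HolomorphicCechH1.lean`,
  `subsingleton_dolbeaultCohomology_zero_one_of_subsingleton_H_one`): on a compact complex manifold
  `M`, `H¹(M, 𝒪_M) = 0` (sheaf cohomology `Sheaf.H 1` of the abelian sheaf of the `𝒪_M`-module
  `𝒪_M`, Mathlib) forces `H^{0,1}_{∂̄}(M) = 0` (finite Leray cover + Čech–Dolbeault);
* HODGE-THEORETIC half (`K3BettiNumbersProofs.lean`,
  `Huybrechts_K3_oddBetti_vanish_of_subsingleton_dolbeaultCohomology`): `H^{0,1}_{∂̄}(S^an) = 0`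
  on some Hodge model gives `b₁ = 0` (Hodge decomposition and symmetry in degree one) and `b₃ = 0`
  (Poincaré duality).

Result: `Huybrechts_K3_oddBetti_vanish_of_subsingleton_H_one` — **the named fact follows from
`H¹(S^an, 𝒪_{S^an}) = 0` for (some, equivalently every) Hodge model `S^an` of every projective K3
surface `S`**, the hypothesis being verbatim the output of Serre's comparison theorem
`H¹(S, 𝒪_S) ≅ H¹(S^an, 𝒪_{S^an})` (GAGA §3 n°12 Thm. 1, `q = 1`, `F = 𝒪_S`) applied to the clause
`H¹(S, 𝒪_S) = 0` of `IsK3Surface` (Zariski cohomology `Motives.structureSheafCohomology S.left 1`).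
That comparison — for the structure sheaf of a smooth projective surface, in vanishing form
`H¹(S, 𝒪_S) = 0 → H¹(S^an, 𝒪_{S^an}) = 0` — is the one remaining non-formalised input of the named
fact; the tree relates `Motives.structureSheafCohomology` to no analytic object
(`Motives/GAGA.lean`: coherent GAGA "blocked"). This file is the reduction, not the discharge.

## References

* [Huybrechts2016K3] D. Huybrechts, Lectures on K3 Surfaces (CUP 2016), Ch. 1 Def. 1.1, §3.1
  (Prop. 3.2: GAGA), §3.2, §3.3.
* [SerreGAGA1956] J.-P. Serre, Géométrie algébrique et géométrie analytique, Ann. Inst. Fourier 6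
  (1956), §2 n°7 Prop. 6, §3 n°12 Thm. 1.
* [VoisinHodgeI2002] C. Voisin, Hodge Theory and Complex Algebraic Geometry I (2002), Cor. 4.38,
  §6.1.3 Cor. 6.14.
-/

noncomputable section

open scoped Manifold ContDiff
open CategoryTheory
open Literature.NumberTheory.Transcendental Literature.Geometry.ComplexAnalytic

namespace Literature.AlgebraicGeometry.Surfaces

/-- **`H¹(X^an, 𝒪_{X^an}) = 0 ⟹ H^{0,1}_{∂̄}(X^an) = 0` on a Hodge model of a smooth projective
`X`**: the Hodge model `A.carrier ≅ X^an` is compact (`X` proper, GAGA §2 n°7 Prop. 6: the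
comparison map is a homeomorphism onto the compact `X(ℂ)`), so the degree-one vanishing half of
Dolbeault's theorem on compact complex manifolds
(`subsingleton_dolbeaultCohomology_zero_one_of_subsingleton_H_one`: finite Leray cover by convex
chart sets, Čech–Dolbeault isomorphism, injectivity of `Ȟ¹(𝔘, 𝒪) → H¹(M, 𝒪)`) applies.
[cite: VoisinHodgeI2002, Cor. 4.38] [cite: SerreGAGA1956, §2 n°7 Prop. 6] -/
theorem subsingleton_dolbeaultCohomology_zero_one_of_subsingleton_H_one_hodgeModel
    {n : ℕ} {X : Motives.SchemeOver ℂ} (hX : Motives.IsSmoothProjective n X)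
    (A : HodgeTheory.HodgeModel n X)
    (h : Subsingleton (((SheafOfModules.toSheaf
      (holomorphicRingCatSheaf 𝓘(ℂ, A.model) A.carrier)).obj (SheafOfModules.unit _)).H 1)) :
    Subsingleton (dolbeaultCohomology A.model A.carrier 0 1) := by
  haveI : AlgebraicGeometry.IsProper X.hom := Motives.IsSmoothProjective.isProper_holds hX
  haveI : CompactSpace (Motives.ComplexPoints X) :=
    Motives.compactSpace_algPoints_of_isProper_holds X ℂ
  haveI : CompactSpace A.carrier := A.isAnalytification.homeomorph.symm.compactSpace
  haveI := h
  exact subsingleton_dolbeaultCohomology_zero_one_of_subsingleton_H_one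

/-- **`Huybrechts_K3_oddBetti_vanish` from GAGA Thm. 1 for `H¹(S, 𝒪_S)`, derived-functor form.**
If every projective K3 surface `S` has SOME Hodge model `S^an` (its analytification; all Hodge
models are biholomorphic over `S(ℂ)`) whose structure sheaf has `H¹(S^an, 𝒪_{S^an}) = 0` — which is
the clause `H¹(S, 𝒪_S) = 0` of `IsK3Surface` (Huybrechts Ch. 1 Def. 1.1) transported by Serre's
comparison `H¹(S, 𝒪_S) ≅ H¹(S^an, 𝒪_{S^an})` (GAGA §3 n°12 Thm. 1; Huybrechts Ch. 1 §3.1 Prop. 3.2: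
"`H^*(X, F) ≃ H^*(X^an, F^an)` for all coherent sheaves `F` on `X`"), NOT in the tree — then
`b₁(S) = b₃(S) = 0`: `H^{0,1}_{∂̄}(S^an) = 0`
(`subsingleton_dolbeaultCohomology_zero_one_of_subsingleton_H_one_hodgeModel`), then the
Hodge-theoretic reduction and Poincaré duality
(`Huybrechts_K3_oddBetti_vanish_of_subsingleton_dolbeaultCohomology`). Huybrechts Ch. 1 §3.2–3.3:
"`H¹(X, 𝒪) = 0` … shows `H¹(X, ℤ) = 0` and by Poincaré duality also `H³(X, ℤ) = 0`", "hence
`H¹(X, ℂ) = 0`". This is the reduction, not the discharge.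
[cite: Huybrechts2016K3, Ch. 1 §3.1 Prop. 3.2 and §3.2–3.3] [cite: SerreGAGA1956, §3 n°12 Thm. 1] -/
theorem Huybrechts_K3_oddBetti_vanish_of_subsingleton_H_one
    (h : ∀ S : Motives.SchemeOver ℂ, IsK3Surface S →
      ∃ A : HodgeTheory.HodgeModel 2 S,
        Subsingleton (((SheafOfModules.toSheaf
          (holomorphicRingCatSheaf 𝓘(ℂ, A.model) A.carrier)).obj (SheafOfModules.unit _)).H 1)) :
    Huybrechts_K3_oddBetti_vanish := by
  refine Huybrechts_K3_oddBetti_vanish_of_subsingleton_dolbeaultCohomology fun S hS ↦ ?_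
  obtain ⟨A, hA⟩ := h S hS
  exact ⟨A, subsingleton_dolbeaultCohomology_zero_one_of_subsingleton_H_one_hodgeModel
    hS.isSmoothProjective A hA⟩

/-- **The same for EVERY Hodge model** (consumer form: a GAGA comparison is proved for whatever
analytification it is handed): if for every projective K3 surface `S` and every Hodge model `A` of
`S` the structure sheaf of `A.carrier ≅ S^an` has `H¹ = 0`, the named fact holds. A K3 surface comes
with a Hodge model (`IsK3Surface` contains one), so this is a special case of
`Huybrechts_K3_oddBetti_vanish_of_subsingleton_H_one`.
[cite: Huybrechts2016K3, Ch. 1 §3.1 Prop. 3.2 and §3.2–3.3] [cite: SerreGAGA1956, §3 n°12 Thm. 1] -/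
theorem Huybrechts_K3_oddBetti_vanish_of_forall_hodgeModel_subsingleton_H_one
    (h : ∀ S : Motives.SchemeOver ℂ, IsK3Surface S → ∀ A : HodgeTheory.HodgeModel 2 S,
        Subsingleton (((SheafOfModules.toSheaf
          (holomorphicRingCatSheaf 𝓘(ℂ, A.model) A.carrier)).obj (SheafOfModules.unit _)).H 1)) :
    Huybrechts_K3_oddBetti_vanish := by
  refine Huybrechts_K3_oddBetti_vanish_of_subsingleton_H_one fun S hS ↦ ?_
  obtain ⟨A, -⟩ := hS.exists_holomorphicTwoForm_ne_zero
  exact ⟨A, h S hS A⟩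

end Literature.AlgebraicGeometry.Surfaces

end
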